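import Mathlib
import Summits.ResolutionOfSingularities.ResolutionOfSingularities.Theorems.WeightedInvariantLocalWeightedDropTOT2BridgePresentedStepCurve
import Summits.ResolutionOfSingularities.ResolutionOfSingularities.Theorems.WeightedInvariantLocalWeightedDropPolyDescentSelNoChain
import Summits.ResolutionOfSingularities.ResolutionOfSingularities.Theorems.WeightedInvariantLocalWeightedDropTOT2BridgeDecorated

/-!
# TOT2-LINE v1.3, regime (P): the DECORATED STEP of the lazy strategy — the POINT branch (res-L1-w43-stub-2 g5, work order (P2c) part 2)

Sub-problem `ResolutionOfSingularities`, ENGINE crux `stmt-ResolutionOfSingularities-8899` (`LocalWeightedDrop`), inner tame loop at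
`m + 1 = 3`, S-ASM by regimes (res-L1-w43-lead-1 g5 memo TOT2-LINE v1.3 §3 (P2)); continuation of …TOT2BridgePresentedStepCurve.

* `Decoration.presented_exit_of_mem_succTWP` — THE SAME-HEAD EXIT READER: a same-head admissible successor presented by a lazy successor label
  `B ∈ PolyDescent.succTWP d A` is either presented in the polygon regime (`InPoly d B`) or in the APEX COLUMN (`HCol`): by the exit
  trichotomy of the lazy strategy (`PolyDescent.exit_cases_WP`) the only other possibilities are an empty Newton set — impossible at `o ≥ 2`
  (`Decoration.newtonSet_nonempty_of_presentation`) — or a well-prepared non-position, which is the apex column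
  (`Decoration.hCol_of_presentation_of_not_isPosT`).
* `Decoration.presentation_recentre` — LAZY PREPARATION IS A RE-PRESENTATION: when no boundary letter is straightened to `y`, composing the
  presentation with the re-centring `y ↦ y + φ(u)` presents the same state by the shifted label `shift d L φ` (old-letter invariant kept,
  vacuously).
* **`Decoration.moveClause_presented_point`** — the POINT branch of the decorated step (no curve of the lazy strategy available): the point move
  `(Φ₀, 𝟙)` is answered by a head drop (far answer `γ ≠ 0`: order letter `0`; or smaller head), or a same-head successor in the apex column,
  or a same-head successor PRESENTED by a member of the lazy point branch `{blowOne A, blowTwo A} ∪ {blowOne (shift (shear_λ A) (prepSelWP _))}`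
  in the polygon regime — the re-centring being invisible when an old letter is present (`A₀ = 0` ⇒ the sheared label is well-prepared ⇒
  the lazy selector returns `0`) and harmless otherwise.

All statements are ours (engine bookkeeping); nothing here is a statement of [CJS] or [CP-char2].
-/

set_option linter.dupNamespace false -- mandated namespace of this single-conjunct summit

noncomputable section

namespace Summit.ResolutionOfSingularities.ResolutionOfSingularities.Theorems

namespace TameFourTupleDrop

open MvPowerSeries Literature.AlgebraicGeometry.Resolution

variable {k : Type} [Field k]

/-! ## Private substitution calculus (as in …TOT2BridgePresentedEntry) -/

/-- Constant terms of a composite. -/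
private theorem constantCoeff_comp_eq_zero'' {n : ℕ} {φ θ : Fin n → MvPowerSeries (Fin n) k}
    (hφ0 : ∀ i, constantCoeff (φ i) = 0) (hθ0 : ∀ i, constantCoeff (θ i) = 0) (i : Fin n) : constantCoeff (subst θ (φ i)) = 0 :=
  constantCoeff_subst_eq_zero (hasSubst_of_constantCoeff_zero hθ0) hθ0 (hφ0 i)

/-- Chain rule for linear parts. -/
private theorem linMat_comp'' {n : ℕ} (φ : Fin n → MvPowerSeries (Fin n) k) {θ : Fin n → MvPowerSeries (Fin n) k}
    (hθ0 : ∀ i, constantCoeff (θ i) = 0) :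
    FormalCoordChange.linMat (fun i => subst θ (φ i)) = FormalCoordChange.linMat φ * FormalCoordChange.linMat θ := by
  ext i j
  simp only [FormalCoordChange.linMat, Matrix.of_apply, Matrix.mul_apply]
  exact CobordantArc.coeff_degree_one_subst θ hθ0 (φ i) _ (Finsupp.degree_single _ _)

/-- Composition of substitutions. -/
private theorem subst_subst_eq_subst_comp'' {n : ℕ} {φ θ : Fin n → MvPowerSeries (Fin n) k}
    (hφ0 : ∀ i, constantCoeff (φ i) = 0) (hθ0 : ∀ i, constantCoeff (θ i) = 0) (f : MvPowerSeries (Fin n) k) :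
    subst θ (subst φ f) = subst (fun i => subst θ (φ i)) f :=
  subst_comp_subst_apply (hasSubst_of_constantCoeff_zero hφ0) (hasSubst_of_constantCoeff_zero hθ0) f

/-- A coordinate straightened to a `u`-letter up to a unit has straightening index `≠ y`. -/
theorem strIdx_ne_last_of_eq_unit_mul_X {Θ' : Fin (2 + 1) → MvPowerSeries (Fin (2 + 1)) k} {l : Fin (2 + 1)} {j : Fin 2}
    {u : MvPowerSeries (Fin (2 + 1)) k} (hu : constantCoeff u ≠ 0) (h : Θ' l = u * X (Fin.castSucc j)) : strIdx Θ' l ≠ Fin.last 2 := by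
  classical
  intro hlast
  obtain ⟨v, -, hv⟩ := strIdx_spec (Φ := Θ') (l := l) ⟨Fin.castSucc j, u, hu, h⟩
  rw [hlast] at hv
  have hdvd : (X (Fin.last 2) : MvPowerSeries (Fin (2 + 1)) k) ∣ Θ' l := hv ▸ Dvd.intro_left v rfl
  rw [X_dvd_iff] at hdvd
  have h0 := hdvd (Finsupp.single (Fin.castSucc j) 1) (by
    rw [Finsupp.single_apply, if_neg (Fin.castSucc_lt_last j).ne])
  rw [h, X, coeff_mul_monomial, if_pos le_rfl, tsub_self, mul_one, coeff_zero_eq_constantCoeff] at h0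
  exact hu h0

section Exit

variable {b' : MvPowerSeries (Fin (2 + 1)) k} {δ' : Decoration k 2} {Θ' : Fin (2 + 1) → MvPowerSeries (Fin (2 + 1)) k}
  {H' : MvPowerSeries (Fin (2 + 1)) k} {d : ℕ} {A B : Fin d → MvPowerSeries (Fin 2) k}

/-- **THE SAME-HEAD EXIT READER** (`k` algebraically closed): a state of order letter `o′ ≥ 2` and `c′ = d`, presented by a lazy successor
label `B ∈ succTWP d A` of a label `A` in the polygon regime, is presented IN THE POLYGON REGIME or lies in the APEX COLUMN. -/
theorem Decoration.presented_exit_of_mem_succTWP [IsAlgClosed k] (hadm' : Admissible b' δ') (hcd' : δ'.c = d) (hd : 0 < d)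
    (ho' : 2 ≤ δ'.o) (hperm' : IsBPermissible δ' Θ' (fun _ => 1)) (hH' : constantCoeff H' ≠ 0)
    (hP' : subst Θ' (δ'.f * ∏ l ∈ δ'.O, X l) = H' * NCPoly.monicGerm d B) (hin : PolyDescent.InPoly d A)
    (hB : B ∈ PolyDescent.succTWP d A) : δ'.HCol ∨ PolyDescent.InPoly d B := by
  by_cases hin' : PolyDescent.InPoly d B
  · exact Or.inr hin'
  · left
    have hWP' : PolyDescent.WellPrepared d B := PolyDescent.wellPrepared_of_mem_succTSel hd
      (fun _ hX => PolyDescent.isPrepRecentring_prepSelWP (PolyDescent.stub_polyPrep k d hd) hX) hin.1 hin.2.1 hB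
    rcases PolyDescent.exit_cases_WP hd hin hB hin' with hne | hnpos
    · exact absurd (Decoration.newtonSet_nonempty_of_presentation hadm' hperm'.1.1 hperm'.1.2.1 hperm'.2.2.2 hH' hP' hcd' ho') hne
    · exact Decoration.hCol_of_presentation_of_not_isPosT hadm' hperm'.1.1 hperm'.1.2.1 hH' hd hP' hcd' hWP' hnpos

end Exit

section Recentre

variable {δ : Decoration k 2} {Θ : Fin (2 + 1) → MvPowerSeries (Fin (2 + 1)) k} {H : MvPowerSeries (Fin (2 + 1)) k} {d : ℕ}
  {L : Fin d → MvPowerSeries (Fin 2) k} {φ : MvPowerSeries (Fin 2) k}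

/-- **LAZY PREPARATION IS A RE-PRESENTATION**: when no boundary letter is straightened to `y`, composing a point-B-permissible presentation with
the re-centring `y ↦ y + φ(u)` (`φ(0) = 0`) presents the same state by the shifted label `shift d L φ`, again point-B-permissibly, again with no
boundary letter straightened to `y`. -/
theorem Decoration.presentation_recentre (hperm : IsBPermissible δ Θ (fun _ => 1)) (hny : ∀ l ∈ δ.E, strIdx Θ l ≠ Fin.last 2)
    (hH : constantCoeff H ≠ 0) (hP : subst Θ (δ.f * ∏ l ∈ δ.O, X l) = H * NCPoly.monicGerm d L) (hφ : constantCoeff φ = 0) :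
    ∃ (Θ'' : Fin (2 + 1) → MvPowerSeries (Fin (2 + 1)) k) (H'' : MvPowerSeries (Fin (2 + 1)) k),
      IsBPermissible δ Θ'' (fun _ => 1) ∧ (∀ l ∈ δ.E, strIdx Θ'' l ≠ Fin.last 2) ∧ constantCoeff H'' ≠ 0 ∧
      subst Θ'' (δ.f * ∏ l ∈ δ.O, X l) = H'' * NCPoly.monicGerm d (WildMonic.shift d L φ) := by
  classical
  obtain ⟨⟨hΘ0, hΘdet, -⟩, -, -, hP3⟩ := hperm
  have hR0 : ∀ i, constantCoeff (NCPoly.recentre φ i) = 0 := NCPoly.constantCoeff_recentre hφ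
  have hRs : HasSubst (NCPoly.recentre φ) := hasSubst_of_constantCoeff_zero hR0
  set Θ'' : Fin (2 + 1) → MvPowerSeries (Fin (2 + 1)) k := fun i => subst (NCPoly.recentre φ) (Θ i) with hΘ''
  have hΘ''0 : ∀ i, constantCoeff (Θ'' i) = 0 := constantCoeff_comp_eq_zero'' hΘ0 hR0
  have hΘ''det : IsUnit (FormalCoordChange.linMat Θ'').det := by
    rw [hΘ'', linMat_comp'' Θ hR0, Matrix.det_mul]
    exact hΘdet.mul (NCPoly.isUnit_det_linMat_recentre φ)
  -- straightening: every boundary letter goes to a `u`-letter, fixed by the re-centring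
  have hstr : ∀ l ∈ δ.E, ∃ (j : Fin 2) (u : MvPowerSeries (Fin (2 + 1)) k), constantCoeff u ≠ 0 ∧ Θ'' l = u * X (Fin.castSucc j) := by
    intro l hl
    obtain ⟨u, hu, hul⟩ := strIdx_spec (hP3 l hl)
    obtain ⟨j, hj⟩ : ∃ j : Fin 2, strIdx Θ l = Fin.castSucc j := by
      rcases Fin.eq_castSucc_or_eq_last (strIdx Θ l) with ⟨j, hj⟩ | hlast
      · exact ⟨j, hj⟩
      · exact absurd hlast (hny l hl)
    refine ⟨j, subst (NCPoly.recentre φ) u, by rwa [WildTerminal.constantCoeff_subst_of_constantCoeff_zero hR0], ?_⟩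
    simp only [hΘ'']
    rw [hul, hj, ← coe_substAlgHom hRs, map_mul, coe_substAlgHom, subst_X hRs,
      NCPoly.recentre_of_ne φ (Fin.castSucc_lt_last j).ne]
  have hP3'' : ∀ l ∈ δ.E, ∃ (l' : Fin (2 + 1)) (u : MvPowerSeries (Fin (2 + 1)) k), constantCoeff u ≠ 0 ∧ Θ'' l = u * X l' :=
    fun l hl => by obtain ⟨j, u, hu, h⟩ := hstr l hl; exact ⟨Fin.castSucc j, u, hu, h⟩
  have hmv'' : IsCountMove Θ'' (fun _ => 1) :=
    ⟨hΘ''0, hΘ''det, fun _ => le_rfl, ⟨0, Nat.one_pos⟩⟩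
  refine ⟨Θ'', subst (NCPoly.recentre φ) H, isBPermissible_point hmv'' hP3'', fun l hl => ?_,
    by rwa [WildTerminal.constantCoeff_subst_of_constantCoeff_zero hR0], ?_⟩
  · obtain ⟨j, u, hu, h⟩ := hstr l hl
    exact strIdx_ne_last_of_eq_unit_mul_X hu h
  · rw [hΘ'', ← subst_subst_eq_subst_comp'' hΘ0 hR0, hP, ← coe_substAlgHom hRs, map_mul, coe_substAlgHom,
      NCPoly.subst_recentre_monicGerm hφ]

end Recentre

section Point

variable {b : MvPowerSeries (Fin (2 + 1)) k} {δ : Decoration k 2} {Φ₀ : Fin (2 + 1) → MvPowerSeries (Fin (2 + 1)) k}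
  {U : MvPowerSeries (Fin (2 + 1)) k} {d : ℕ} {A : Fin d → MvPowerSeries (Fin 2) k}

/-- A nonzero answer to the point move with `γ = 0` and `c₀ = 0` has `c₁ ≠ 0`. -/
theorem pointAnswer_one_ne_zero {pt : Fin (2 + 1) → k} (hpt : pt ≠ 0) (hγ : pt (Fin.last 2) = 0) (hc0 : pt 0 = 0) : pt 1 ≠ 0 := by
  intro h1
  apply hpt
  funext l
  fin_cases l
  · exact hc0
  · exact h1
  · exact hγ

/-- **DECORATED STEP, POINT BRANCH** (`k` algebraically closed): at a presented state whose label admits no curve of the lazy strategy, the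
point move `(Φ₀, 𝟙)` is answered, at some live slot, by an admissible successor that DROPS THE HEAD, or keeps the head and is in the APEX
COLUMN, or keeps the head and is PRESENTED by a member of the lazy point branch of `succTWP d A` in the polygon regime, with the old-letter
invariant. -/
theorem Decoration.moveClause_presented_point [IsAlgClosed k] (hadm : Admissible b δ)
    (hperm₁ : IsBPermissible δ Φ₀ (fun _ => 1)) (hOld : ∀ l ∈ δ.E, strIdx Φ₀ l = Fin.last 2 → l ∈ δ.O)
    (hU : constantCoeff U ≠ 0) (hd : 0 < d) (hP : subst Φ₀ (δ.f * ∏ l ∈ δ.O, X l) = U * NCPoly.monicGerm d A)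
    (hin : PolyDescent.InPoly d A) (ho : 2 ≤ δ.o) (h1 : ¬ PolyDescent.IsPermissibleOneT d A)
    (h2 : ¬ PolyDescent.IsPermissibleTwoT d A) (h3 : ¬ PolyDescent.HasGraphCurveT d A) :
    MoveClause b Φ₀ (fun _ => 1)
      (fun b' => ∃ δ' : Decoration k 2, Admissible b' δ' ∧ (δ'.head < δ.head ∨ (δ'.head = δ.head ∧ (δ'.HCol ∨
        ∃ (Θ' : Fin 3 → MvPowerSeries (Fin 3) k) (H' : MvPowerSeries (Fin 3) k) (A' : Fin d → MvPowerSeries (Fin 2) k),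
          IsBPermissible δ' Θ' (fun _ => 1) ∧ (∀ l ∈ δ'.E, strIdx Θ' l = Fin.last 2 → l ∈ δ'.O) ∧ constantCoeff H' ≠ 0 ∧
          subst Θ' (δ'.f * ∏ l ∈ δ'.O, X l) = H' * NCPoly.monicGerm d A' ∧ A' ∈ PolyDescent.succTWP d A ∧
          PolyDescent.InPoly d A')))) := by
  classical
  have hf : δ.f ≠ 0 := hadm.2.1.ne_zero
  have hcd : δ.c = d := Decoration.c_eq_of_presentation hadm hperm₁.1.1 hperm₁.1.2.1 hU hP hin.2.1
  have hsucc : PolyDescent.succTWP d A = {PolyDescent.blowOneT d A, PolyDescent.blowTwoT d A} ∪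
      {B | ∃ c : k, c ≠ 0 ∧ B = PolyDescent.blowOneT d (WildMonic.shift d (PolyDescent.shearT (C c) A)
        (PolyDescent.prepSelWP d (PolyDescent.shearT (C c) A)))} := by
    rw [PolyDescent.succTWP, PolyDescent.succTSel_of_point _ h1 h2 h3]
  -- the finishing step at a same-head answer presented by a lazy successor label
  have finish : ∀ {b' : MvPowerSeries (Fin (2 + 1)) k} {δ' : Decoration k 2} {Θ' : Fin 3 → MvPowerSeries (Fin 3) k}
      {H' : MvPowerSeries (Fin 3) k} {B : Fin d → MvPowerSeries (Fin 2) k},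
      Admissible b' δ' → δ'.head = δ.head → δ'.c = d → 2 ≤ δ'.o → IsBPermissible δ' Θ' (fun _ => 1) →
      (∀ l ∈ δ'.E, strIdx Θ' l = Fin.last 2 → l ∈ δ'.O) → constantCoeff H' ≠ 0 →
      subst Θ' (δ'.f * ∏ l ∈ δ'.O, X l) = H' * NCPoly.monicGerm d B → B ∈ PolyDescent.succTWP d A →
      ∃ δ'' : Decoration k 2, Admissible b' δ'' ∧ (δ''.head < δ.head ∨ (δ''.head = δ.head ∧ (δ''.HCol ∨
        ∃ (Θ' : Fin 3 → MvPowerSeries (Fin 3) k) (H' : MvPowerSeries (Fin 3) k) (A' : Fin d → MvPowerSeries (Fin 2) k),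
          IsBPermissible δ'' Θ' (fun _ => 1) ∧ (∀ l ∈ δ''.E, strIdx Θ' l = Fin.last 2 → l ∈ δ''.O) ∧ constantCoeff H' ≠ 0 ∧
          subst Θ' (δ''.f * ∏ l ∈ δ''.O, X l) = H' * NCPoly.monicGerm d A' ∧ A' ∈ PolyDescent.succTWP d A ∧
          PolyDescent.InPoly d A'))) := by
    intro b' δ' Θ' H' B hadm' hhead hcd' ho' hperm' hOld' hH' hP' hB
    refine ⟨δ', hadm', Or.inr ⟨hhead, ?_⟩⟩
    rcases Decoration.presented_exit_of_mem_succTWP hadm' hcd' hd ho' hperm' hH' hP' hin hB with hcol | hin'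
    · exact Or.inl hcol
    · exact Or.inr ⟨Θ', H', B, hperm', hOld', hH', hP', hB, hin'⟩
  intro pt hconv hpt Aexp G hfac hG
  by_cases hγ : pt (Fin.last 2) = 0
  · by_cases hc0 : pt 0 = 0
    · -- slot `u₂`: label `blowTwo A`
      have hc1 : pt 1 ≠ 0 := pointAnswer_one_ne_zero hpt hγ hc0
      have hc1' : pt (Fin.castSucc 1) ≠ 0 := hc1
      have hadm' := admissible_transform hadm hperm₁ hconv hfac hG hc1'
      rcases (Decoration.head_transform_le hperm₁ hconv hf hc1').lt_or_eq with hlt | heq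
      · exact ⟨Fin.castSucc 1, hc1', _, hadm', Or.inl hlt⟩
      · have hnear := Decoration.o_transform_eq_of_head_eq' heq
        obtain ⟨Θ', H', hperm', hΘ'c, -, hH', hP'⟩ :=
          Decoration.presentation_pointSucc_one hperm₁ hf hU hin.2.1 hP hγ hc0 hc1 hnear
        refine ⟨Fin.castSucc 1, hc1', finish hadm' heq ((Decoration.c_transform_eq_of_head_eq' heq).trans hcd) (hnear.symm ▸ ho)
          hperm' (Decoration.old_of_strIdx_last_transform heq hΘ'c hOld) hH' hP' ?_⟩
        rw [hsucc]
        exact Set.mem_union_left _ (Set.mem_insert_of_mem _ rfl)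
    · -- slot `u₁`: label `blowOne (shear_λ A)`, `λ = c₁/c₀`, lazily prepared
      have hc0' : pt (Fin.castSucc 0) ≠ 0 := hc0
      have hadm' := admissible_transform hadm hperm₁ hconv hfac hG hc0'
      rcases (Decoration.head_transform_le hperm₁ hconv hf hc0').lt_or_eq with hlt | heq
      · exact ⟨Fin.castSucc 0, hc0', _, hadm', Or.inl hlt⟩
      · have hnear := Decoration.o_transform_eq_of_head_eq' heq
        have hcd' := (Decoration.c_transform_eq_of_head_eq' heq).trans hcd
        have ho' : 2 ≤ (δ.transform Φ₀ (fun _ => 1) pt (Fin.castSucc 0)).o := hnear.symm ▸ ho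
        obtain ⟨Θ', H', hperm', hΘ'c, -, hH', hP'⟩ :=
          Decoration.presentation_pointSucc_zero hperm₁ hf hU hin.2.1 hP hγ hc0 hnear
        have hOld' := Decoration.old_of_strIdx_last_transform heq hΘ'c hOld
        refine ⟨Fin.castSucc 0, hc0', ?_⟩
        by_cases hl : pt 1 / pt 0 = 0
        · -- `λ = 0`: label `blowOne A`
          have hsh : PolyDescent.shearT (C (pt 1 / pt 0)) A = A := by rw [hl, map_zero]; exact PolyDescent.shearT_zero A
          rw [hsh] at hP'
          refine finish hadm' heq hcd' ho' hperm' hOld' hH' hP' ?_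
          rw [hsucc]
          exact Set.mem_union_left _ (Set.mem_insert _ _)
        · set Y := PolyDescent.shearT (C (pt 1 / pt 0)) A with hY
          by_cases hWPY : PolyDescent.WellPrepared d Y
          · -- the sheared label is well-prepared: the lazy selector returns `0`
            refine finish hadm' heq hcd' ho' hperm' hOld' hH' hP' ?_
            rw [hsucc]
            refine Set.mem_union_right _ ⟨pt 1 / pt 0, hl, ?_⟩
            rw [← hY, PolyDescent.prepSelWP_of_wellPrepared hWPY, WildMonic.shift_zero]
          · -- a genuine re-centring: then NO boundary letter of the successor is straightened to `y`
            have hposY : PolyDescent.IsPosT d Y := PolyDescent.isPosT_shearT _ hin.2.1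
            obtain ⟨hχ0, hposB, -, -⟩ := PolyDescent.isPrepRecentring_prepSelWP (PolyDescent.stub_polyPrep k d hd) hposY
            set χ := PolyDescent.prepSelWP d Y with hχ
            have hχ1 : (1 : ℕ∞) ≤ χ.order := nat_le_order fun e he => by
              have he0 : e = 0 := by
                have : e.degree = 0 := by exact_mod_cast Nat.lt_one_iff.mp (by exact_mod_cast he)
                exact (Finsupp.degree_eq_zero_iff e).mp this
              rw [he0, coeff_zero_eq_constantCoeff_apply, hχ0]
            have hcomm := PolyDescent.blowOneT_shift Y _ (fun j => (hposY j).le) hχ1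
            have hchi1 : constantCoeff (MonicDescent.blowOne 1 χ) = 0 := by
              rw [MonicDescent.constantCoeff_blowOne_one_eq]
              exact PolyDescent.coeff_single_one_eq_zero_of_isPosT_shift hd hposY hχ0 hposB 0
            -- no successor boundary letter is straightened to `y`: else an old letter exists, `A₀ = 0`, `Y₀ = 0`, `Y` well-prepared
            have hny : ∀ l ∈ (δ.transform Φ₀ (fun _ => 1) pt (Fin.castSucc 0)).E, strIdx Θ' l ≠ Fin.last 2 := by
              intro l hl hlast
              have hO' : (δ.transform Φ₀ (fun _ => 1) pt (Fin.castSucc 0)).O.Nonempty := ⟨l, hOld' l hl hlast⟩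
              rw [Decoration.O_transform_eq_of_head_eq' heq] at hO'
              obtain ⟨l', hl'⟩ := hO'
              unfold Decoration.newLetters at hl'
              obtain ⟨l₀, hl₀, -⟩ := Finset.mem_image.mp hl'
              have hO : δ.O.Nonempty := ⟨l₀, (Finset.mem_filter.mp hl₀).1⟩
              have hA0 : A ⟨0, hd⟩ = 0 := apply_zero_eq_zero_of_presentation hperm₁ hU hP hd hO
              exact hWPY (PolyDescent.wellPrepared_of_apply_zero_eq_zero hd (PolyDescent.shearT_apply_zero hd _ hA0))
            obtain ⟨Θ'', H'', hperm'', hny'', hH'', hP''⟩ := Decoration.presentation_recentre hperm' hny hH' hP' hchi1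
            refine finish hadm' heq hcd' ho' hperm'' (fun l hl hlast => absurd hlast (hny'' l hl)) hH'' hP'' ?_
            rw [hsucc]
            refine Set.mem_union_right _ ⟨pt 1 / pt 0, hl, ?_⟩
            rw [← hY, ← hχ, hcomm]
  · -- far answer: the order letter drops to `0`
    have hγ0 : pt (Fin.last 2) ≠ 0 := hγ
    have hadm' := admissible_transform hadm hperm₁ hconv hfac hG hγ0
    refine ⟨Fin.last 2, hγ0, _, hadm', Or.inl (Decoration.head_transform_lt_of_o_lt ?_)⟩
    rw [o_transform_eq_zero_of_gamma_ne_zero hperm₁ hf hU hin.2.1 hP hγ0 (Fin.last 2)]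
    omega

end Point

end TameFourTupleDrop

end Summit.ResolutionOfSingularities.ResolutionOfSingularities.Theorems

end
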